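import Literature.NumberTheory.Automorphic.SLTwoTreeQuadraticTorusEisenstein   -- ★ (W′1) VI (A-p17 (g23)) p844118: Eisenstein ⇒ `hE`, `δ_m = 2q^m`; ⊇ I–V, V-INDEX
import HarnessLib

/-!
# The non-split quadratic torus on the tree of `SL₂(F)`, VII: SHELL BALLS `SV M₁ = {M | d M ≤ M₁}` — finiteness, `T`-invariance and the shell counts inside them
# (the `SV ∕ hSV ∕ hs` binders and the coefficients of the (Ψ1) shell sum; Labesse–Langlands 1979, §2 p. 8)

Topic `NumberTheory/Automorphic`; namespace `Literature.NumberTheory.Automorphic.HermitianLatticeTree` (ROAD W's).  KERNEL mathematics only: theorems, no definition, no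
named fact, no instance, no notation, no `sorry`.  Cell `pub/hodgecm-mathlib` (D-0151), crux H413 = `stmt-HodgeConjecture-24833`, line «N6nsGerm», road «W′» = «R1LL-WILD»
(LEAD F0P3a-plan (g10) WORD T9-25; architect A-p16 (g28) RULING A-44; sub-socket **(B6-C)** of (W′-B6) F0P3-p01 (g14)'s map 12:05:01Z «the count in B-p14's currency:
`∀ m ≤ M₁, {M ∈ SV M₁ | shellIndex M = m}.ncard = 2 * q ^ m` for `SV M₁` the radius-`M₁` ball»).  Seat A-p17 (g23); parts I–VI = ★ p843889 ∕ p843931 ∕ p843948 ∕ p843967 ∕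
p844025 ∕ p844048 ∕ p844118, V-INDEX ★ p844066 (A-p01 (g21)).
HONEST LABEL: HC_CM is proved only modulo the cell's 2 remaining named inputs (hLiu418, h413) until rung 0 closes; nothing printed is asserted here — set bookkeeping over the
shell index of parts III–VI.

THE SPELLING OF RECORD (shared with (B6-H) A-p13 (g32)): with `d : V → ℕ` THE shell index of ★ III `exists_shellIndex` (properties `hd`, `hd'`), the SHELL BALL of radius `M₁`
about the facet of the torus is **`SV M₁ := {M | d M ≤ M₁}`** — a union of the full shells `0, …, M₁`, hence `T`-INVARIANT (§18 `shellIndex_glVertexAct_torus_eq`: the torus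
preserves `d`), which is what makes B-p14 (g33)'s coefficient `{M ∈ SV | d M = i}.ncard` (★ p844070 `integral_conj_eq_sum_ncard_shell_smul_onePlace`) a FULL shell count.
* §18 `shellIndex_glVertexAct_torus_eq`: `d (t · M) = d M` for every torus `t`; `sep_setOf_shellIndex_le_eq`: `{M ∈ SV M₁ | d M = m} = {M | d M = m}` (`m ≤ M₁`) and `= ∅`
  (`m > M₁`); `shellIndex_mem_range_of_mem` (B-p14's `hs` with `s := Finset.range (M₁ + 1)`).
* §19 (Eisenstein hypotheses, finite residue field of cardinality `q`): **`finite_setOf_shellIndex_le_of_eisenstein : (SV M₁).Finite`** (B-p14's `hSV`) and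
  **`ncard_sep_setOf_shellIndex_le_eq_of_eisenstein : {M ∈ SV M₁ | d M = m}.ncard = if m ≤ M₁ then 2 * q ^ m else 0`** — (B6-C) (★ VI `δ_m = 2q^m`).
NOT here: the support bound `Mbound t` with «`f(y⁻¹ t y) ≠ 0 ⇒ d (ρ_w(E₂ y.1)·x₀) ≤ Mbound t`» ((B6-H) A-p13 (g32)); the tree-METRIC reading `d M ≤ dist(M, x₀) ≤ d M + 1` (on request).

## References
* [LabesseLanglands1979] J.-P. Labesse, R. P. Langlands, *L-indistinguishability for SL(2)*, Canad. J. Math. 31 (1979), §2 p. 8 (`δ_m = 2q^m`).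
* [Serre1980Trees] J.-P. Serre, *Trees* (1980), Ch. II §1.1.
-/

set_option autoImplicit false

noncomputable section

open scoped ValuativeRel Matrix MatrixGroups
open Matrix ValuativeRel

namespace Literature.NumberTheory.Automorphic.HermitianLatticeTree

open Literature.NumberTheory.Automorphic Literature.NumberTheory.LocalFields

variable {F : Type*} [Field F] [ValuativeRel F] {ϖ : F} (hϖ : IsUniformizingElement ϖ) [IsDiscreteValuationRing 𝒪[F]]

/-! ## §18 Shells are torus-invariant; shell balls as unions of shells -/

include hϖ in
/-- **THE TORUS PRESERVES THE SHELL INDEX**: `d (t · M) = d M` for every torus element `t = (c, ev; e, c + eu) ∈ GL₂(F)` (with `M = t′ · g_{d M} · v₀`, `t · M = (t t′) · g_{d M} · v₀`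
and `t t′` is a torus element — ★ `mem_centralizer_companion_iff`). Hence every shell ball `{M | d M ≤ M₁}` is `T`-stable. [cite: LabesseLanglands1979, §2 p. 8] -/
theorem shellIndex_glVertexAct_torus_eq {u v c e : F} {γτ : GL (Fin 2) F} (hγτ : (γτ : Matrix (Fin 2) (Fin 2) F) = !![0, v; 1, u])
    {t : GL (Fin 2) F} (ht : (t : Matrix (Fin 2) (Fin 2) F) = !![c, e * v; e, c + e * u])
    (v₀ : {M : Submodule 𝒪[F] (Fin 2 → F) // IsSpecialLattice (RingHom.id F) ϖ !![(0 : F), 1; -1, 0] M})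
    {d : {M : Submodule 𝒪[F] (Fin 2 → F) // IsSpecialLattice (RingHom.id F) ϖ !![(0 : F), 1; -1, 0] M} → ℕ}
    (hd : ∀ x, ∃ (t gm : GL (Fin 2) F) (c e : F), (t : Matrix (Fin 2) (Fin 2) F) = !![c, e * v; e, c + e * u] ∧
      (gm : Matrix (Fin 2) (Fin 2) F) = Matrix.diagonal ![1, ϖ ^ d x] ∧ x = glVertexAct hϖ (t * gm) v₀)
    (hd' : ∀ (x) (t gm : GL (Fin 2) F) (c e : F) (m : ℕ), (t : Matrix (Fin 2) (Fin 2) F) = !![c, e * v; e, c + e * u] →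
      (gm : Matrix (Fin 2) (Fin 2) F) = Matrix.diagonal ![1, ϖ ^ m] → x = glVertexAct hϖ (t * gm) v₀ → d x = m)
    (M : {M : Submodule 𝒪[F] (Fin 2 → F) // IsSpecialLattice (RingHom.id F) ϖ !![(0 : F), 1; -1, 0] M}) :
    d (glVertexAct hϖ t M) = d M := by
  obtain ⟨t', gm, c', e', ht', hgm, hM⟩ := hd M
  have htt' : t * t' ∈ Subgroup.centralizer ({γτ} : Set (GL (Fin 2) F)) :=
    mul_mem ((mem_centralizer_companion_iff hγτ t).2 ⟨c, e, ht⟩) ((mem_centralizer_companion_iff hγτ t').2 ⟨c', e', ht'⟩)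
  obtain ⟨c'', e'', htt''⟩ := (mem_centralizer_companion_iff hγτ (t * t')).1 htt'
  exact hd' _ (t * t') gm c'' e'' (d M) htt'' hgm (by rw [hM, ← glVertexAct_mul, mul_assoc])

omit [ValuativeRel F] [IsDiscreteValuationRing 𝒪[F]] in
/-- The shell-`m` slice of the shell ball of radius `M₁`: all of shell `m` if `m ≤ M₁`, empty otherwise (any index function). [cite: LabesseLanglands1979, §2 p. 8] -/
theorem sep_setOf_shellIndex_le_eq {V : Type*} (d : V → ℕ) (M₁ m : ℕ) :
    {M ∈ {M : V | d M ≤ M₁} | d M = m} = if m ≤ M₁ then {M | d M = m} else ∅ := by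
  ext M
  simp only [Set.mem_setOf_eq]
  split_ifs with h
  · simp only [Set.mem_setOf_eq]
    exact ⟨fun hM => hM.2, fun hM => ⟨hM ▸ h, hM⟩⟩
  · simp only [Set.mem_empty_iff_false, iff_false, not_and]
    intro hle hm
    exact h (hm ▸ hle)

omit [ValuativeRel F] [IsDiscreteValuationRing 𝒪[F]] in
/-- B-p14 (g33)'s `hs` binder for the shell ball: every `M` with `d M ≤ M₁` has `d M ∈ Finset.range (M₁ + 1)`. [cite: LabesseLanglands1979, §2 p. 8] -/
theorem shellIndex_mem_range_of_mem {V : Type*} (d : V → ℕ) (M₁ : ℕ) : ∀ M ∈ {M : V | d M ≤ M₁}, d M ∈ Finset.range (M₁ + 1) :=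
  fun _ hM => Finset.mem_range.2 (Nat.lt_succ_of_le hM)

omit [ValuativeRel F] [IsDiscreteValuationRing 𝒪[F]] in
/-- The shell ball is the union of the shells `0, …, M₁`. [cite: LabesseLanglands1979, §2 p. 8] -/
theorem setOf_shellIndex_le_eq_biUnion {V : Type*} (d : V → ℕ) (M₁ : ℕ) :
    {M : V | d M ≤ M₁} = ⋃ m ∈ Finset.range (M₁ + 1), {M | d M = m} := by
  ext M
  simp only [Set.mem_setOf_eq, Set.mem_iUnion, Finset.mem_range, exists_prop]
  exact ⟨fun h => ⟨d M, Nat.lt_succ_of_le h, rfl⟩, fun ⟨m, hm, hM⟩ => hM ▸ Nat.le_of_lt_succ hm⟩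

/-! ## §19 Finiteness of the shell balls and the counts inside them (Eisenstein hypotheses) -/

include hϖ in
/-- **THE SHELL BALL IS FINITE** (B-p14 (g33)'s `hSV`): under the Eisenstein hypotheses over a finite residue field, `{M | d M ≤ M₁}` is finite (each shell has `2q^m`
elements, ★ VI). [cite: LabesseLanglands1979, §2 p. 8] -/
theorem finite_setOf_shellIndex_le_of_eisenstein [Finite (IsLocalRing.ResidueField 𝒪[F])] {u v : F} (hu : u ∈ 𝒪[F]) (hu1 : valuation F u < 1)
    (hv1 : valuation F v = valuation F ϖ) {γτ : GL (Fin 2) F} (hγτ : (γτ : Matrix (Fin 2) (Fin 2) F) = !![0, v; 1, u])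
    {r : ℕ → GL (Fin 2) F} (hr : ∀ m, (r m : Matrix (Fin 2) (Fin 2) F) = Matrix.diagonal ![1, ϖ ^ m])
    (v₀ : {M : Submodule 𝒪[F] (Fin 2 → F) // IsSpecialLattice (RingHom.id F) ϖ !![(0 : F), 1; -1, 0] M})
    (hv₀ : v₀.1 = latt (1 : Matrix (Fin 2) (Fin 2) F))
    {d : {M : Submodule 𝒪[F] (Fin 2 → F) // IsSpecialLattice (RingHom.id F) ϖ !![(0 : F), 1; -1, 0] M} → ℕ}
    (hd : ∀ x, ∃ (t gm : GL (Fin 2) F) (c e : F), (t : Matrix (Fin 2) (Fin 2) F) = !![c, e * v; e, c + e * u] ∧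
      (gm : Matrix (Fin 2) (Fin 2) F) = Matrix.diagonal ![1, ϖ ^ d x] ∧ x = glVertexAct hϖ (t * gm) v₀)
    (hd' : ∀ (x) (t gm : GL (Fin 2) F) (c e : F) (m : ℕ), (t : Matrix (Fin 2) (Fin 2) F) = !![c, e * v; e, c + e * u] →
      (gm : Matrix (Fin 2) (Fin 2) F) = Matrix.diagonal ![1, ϖ ^ m] → x = glVertexAct hϖ (t * gm) v₀ → d x = m) (M₁ : ℕ) :
    {M | d M ≤ M₁}.Finite := by
  rw [setOf_shellIndex_le_eq_biUnion]
  exact Set.Finite.biUnion (Finset.finite_toSet _) fun m _ =>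
    (ncard_setOf_shellIndex_eq_two_mul_pow_of_eisenstein hϖ hu hu1 hv1 hγτ hr v₀ hv₀ hd hd' m).1

include hϖ in
/-- **(B6-C) THE SHELL COUNTS INSIDE THE SHELL BALL** (the coefficients of ★ B-p14 (g33) `integral_conj_eq_sum_ncard_shell_smul_onePlace` at `SV := {M | d M ≤ M₁}`):
**`#{M ∈ SV M₁ | d M = m} = 2 · q^m`** for `m ≤ M₁` (and `0` beyond) — Labesse–Langlands' `δ_m`. [cite: LabesseLanglands1979, §2 p. 8] -/
theorem ncard_sep_setOf_shellIndex_le_eq_of_eisenstein [Finite (IsLocalRing.ResidueField 𝒪[F])] {u v : F} (hu : u ∈ 𝒪[F]) (hu1 : valuation F u < 1)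
    (hv1 : valuation F v = valuation F ϖ) {γτ : GL (Fin 2) F} (hγτ : (γτ : Matrix (Fin 2) (Fin 2) F) = !![0, v; 1, u])
    {r : ℕ → GL (Fin 2) F} (hr : ∀ m, (r m : Matrix (Fin 2) (Fin 2) F) = Matrix.diagonal ![1, ϖ ^ m])
    (v₀ : {M : Submodule 𝒪[F] (Fin 2 → F) // IsSpecialLattice (RingHom.id F) ϖ !![(0 : F), 1; -1, 0] M})
    (hv₀ : v₀.1 = latt (1 : Matrix (Fin 2) (Fin 2) F))
    {d : {M : Submodule 𝒪[F] (Fin 2 → F) // IsSpecialLattice (RingHom.id F) ϖ !![(0 : F), 1; -1, 0] M} → ℕ}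
    (hd : ∀ x, ∃ (t gm : GL (Fin 2) F) (c e : F), (t : Matrix (Fin 2) (Fin 2) F) = !![c, e * v; e, c + e * u] ∧
      (gm : Matrix (Fin 2) (Fin 2) F) = Matrix.diagonal ![1, ϖ ^ d x] ∧ x = glVertexAct hϖ (t * gm) v₀)
    (hd' : ∀ (x) (t gm : GL (Fin 2) F) (c e : F) (m : ℕ), (t : Matrix (Fin 2) (Fin 2) F) = !![c, e * v; e, c + e * u] →
      (gm : Matrix (Fin 2) (Fin 2) F) = Matrix.diagonal ![1, ϖ ^ m] → x = glVertexAct hϖ (t * gm) v₀ → d x = m) (M₁ m : ℕ) :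
    {M ∈ {M | d M ≤ M₁} | d M = m}.ncard = if m ≤ M₁ then 2 * Nat.card (IsLocalRing.ResidueField 𝒪[F]) ^ m else 0 := by
  rw [sep_setOf_shellIndex_le_eq d M₁ m]
  split_ifs with hm
  · exact (ncard_setOf_shellIndex_eq_two_mul_pow_of_eisenstein hϖ hu hu1 hv1 hγτ hr v₀ hv₀ hd hd' m).2
  · exact Set.ncard_empty _

include hϖ in
/-- (B6-C) in the «`∀ m ≤ M₁`» spelling of F0P3-p01 (g14)'s map: `∀ m ≤ M₁, #{M ∈ SV M₁ | d M = m} = 2 · q^m`. [cite: LabesseLanglands1979, §2 p. 8] -/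
theorem ncard_sep_setOf_shellIndex_le_eq_two_mul_pow_of_eisenstein [Finite (IsLocalRing.ResidueField 𝒪[F])] {u v : F} (hu : u ∈ 𝒪[F])
    (hu1 : valuation F u < 1) (hv1 : valuation F v = valuation F ϖ) {γτ : GL (Fin 2) F} (hγτ : (γτ : Matrix (Fin 2) (Fin 2) F) = !![0, v; 1, u])
    {r : ℕ → GL (Fin 2) F} (hr : ∀ m, (r m : Matrix (Fin 2) (Fin 2) F) = Matrix.diagonal ![1, ϖ ^ m])
    (v₀ : {M : Submodule 𝒪[F] (Fin 2 → F) // IsSpecialLattice (RingHom.id F) ϖ !![(0 : F), 1; -1, 0] M})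
    (hv₀ : v₀.1 = latt (1 : Matrix (Fin 2) (Fin 2) F))
    {d : {M : Submodule 𝒪[F] (Fin 2 → F) // IsSpecialLattice (RingHom.id F) ϖ !![(0 : F), 1; -1, 0] M} → ℕ}
    (hd : ∀ x, ∃ (t gm : GL (Fin 2) F) (c e : F), (t : Matrix (Fin 2) (Fin 2) F) = !![c, e * v; e, c + e * u] ∧
      (gm : Matrix (Fin 2) (Fin 2) F) = Matrix.diagonal ![1, ϖ ^ d x] ∧ x = glVertexAct hϖ (t * gm) v₀)
    (hd' : ∀ (x) (t gm : GL (Fin 2) F) (c e : F) (m : ℕ), (t : Matrix (Fin 2) (Fin 2) F) = !![c, e * v; e, c + e * u] →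
      (gm : Matrix (Fin 2) (Fin 2) F) = Matrix.diagonal ![1, ϖ ^ m] → x = glVertexAct hϖ (t * gm) v₀ → d x = m) (M₁ : ℕ) :
    ∀ m ≤ M₁, {M ∈ {M | d M ≤ M₁} | d M = m}.ncard = 2 * Nat.card (IsLocalRing.ResidueField 𝒪[F]) ^ m := by
  intro m hm
  rw [ncard_sep_setOf_shellIndex_le_eq_of_eisenstein hϖ hu hu1 hv1 hγτ hr v₀ hv₀ hd hd' M₁ m, if_pos hm]

end Literature.NumberTheory.Automorphic.HermitianLatticeTree

end
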